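import Mathlib.Analysis.Complex.Basic
import Mathlib.Analysis.Normed.Group.InfiniteSum
import Mathlib.Topology.Algebra.InfiniteSum.Real
import Mathlib.Tactic.FieldSimp
import Mathlib.Tactic.Linarith
import Mathlib.Tactic.Positivity
import Mathlib.Tactic.Ring
import Summits.QuantumFields.QCD.Theorems.QuarksAsStableActionStableActionBridgeStubNumeratorComparison
import HarnessLib

/-!
# Stub `stub_twistedRatio_cluster` of line `pin-the-infimum`
(crux `Summit.QuantumFields.QCD.Theses.HeatSlicedQuarks.RobustYangMillsHandover`,
item stmt-QuantumFields-8892; step M5 of the Lüscher dictionary: the twisted-ratio clustering algebra)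

Spectral data of a positive compact transfer operator with a parity twist: eigenvalues
`0 ≤ λᵢ ≤ λ_{i₀}` with `λ_{i₀} > 0` the vacuum level, all other levels `≤ l₁`, parities `σᵢ = ±1`
with `σ_{i₀} = 1`; two insertions with matrix elements `X, X'` whose rows AND columns are
square-summable with `ℓ²`-norms at most `BX`, `BX'`; time extent `N`, separation `n ≤ N`; thermal
sums `Σᵢ (λᵢ/λ_{i₀})^N = 1 + δ` (`δ < 1`) and `Σᵢ (λᵢ/λ_{i₀})^{N-n} = 1 + δ'`.  With the twisted
denominator `Z = Σᵢ σᵢ λᵢ^N`, the numerator `Num = Σ_{(i,j)} σᵢ λᵢ^{N-n} λⱼ^n X_{ij} X'_{ji}` and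
the one-point sums `O = Σᵢ σᵢ λᵢ^N X_{ii}`, `O' = Σᵢ σᵢ λᵢ^N X'_{ii}`, the connected twisted ratio
obeys

  `‖Num/Z − (O/Z)(O'/Z)‖ ≤ BX BX' [(1+δ)(ρⁿ(1+δ') + ρ^{N-n}) + 3δ + δ²] / (1−δ)²`, `ρ := l₁/λ_{i₀}`.

Proof.  Normalise by `L := λ_{i₀}^N` (`rᵢ := λᵢ/λ_{i₀}`, `r_{i₀} = 1`, `rᵢ ≤ ρ` off the vacuum).
Removing the vacuum term of each series (`hasSum_ite_sub_hasSum`) and comparing norms termwise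
(`HasSum.norm_le_of_bounded`): `‖Z − 1‖ ≤ δ`; `‖O − X₀₀‖ ≤ δ BX` (`‖X_{ii}‖ ≤ BX`, a single term of
the row bound); `‖Num − X₀₀ X'₀₀‖ ≤ BX BX' (ρⁿ (1 + δ') + ρ^{N-n})`, dominating the off-vacuum
double family by `ρⁿ rᵢ^{N-n} ‖X_{ij}‖ ‖X'_{ji}‖` (columns `j ≠ i₀`; fibrewise Cauchy–Schwarz and
`HasSum.prod_fiberwise`, reused from the sibling stub `stub_numerator_comparison` of crux 9737) plus
`ρ^{N-n} ‖X_{i i₀}‖ ‖X'_{i₀ i}‖` (the column `j = i₀`, transported to `ι × ι` along the injection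
`i ↦ (i, i₀)`).  Finally `Num Z − O O' = X₀₀X'₀₀ (Z−1) + (Num − X₀₀X'₀₀) Z − X₀₀ (O'−X'₀₀) −
(O−X₀₀) X'₀₀ − (O−X₀₀)(O'−X'₀₀)` and `‖Z‖ ≥ 1 − δ > 0`.  Mathlib only. [folklore]
-/

namespace Summit.QuantumFields.QCD.Cruxes.RobustYangMillsHandover.PinTheInfimum

namespace StubTwistedRatioCluster

open Summit.QuantumFields.QCD.Cruxes.StableActionBridge.TwistedTraceTransfer.StubNumeratorComparison

/-- The norm of a sign `s = ±1` seen in `ℂ` is `1`. [folklore] -/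
theorem norm_sign_eq_one {s : ℝ} (hs : s = 1 ∨ s = -1) : ‖(s : ℂ)‖ = 1 := by
  rcases hs with rfl | rfl <;> simp

/-- Norm of a generic term of the twisted double family:
`‖s a^M b^n x y‖ = a^M b^n ‖x‖ ‖y‖` for a sign `s` and `a, b ≥ 0`. [folklore] -/
theorem norm_term_eq {s a b : ℝ} (hs : s = 1 ∨ s = -1) (ha : 0 ≤ a) (hb : 0 ≤ b) (M n : ℕ)
    (x y : ℂ) :
    ‖(s : ℂ) * (a : ℂ) ^ M * (b : ℂ) ^ n * x * y‖ = a ^ M * b ^ n * (‖x‖ * ‖y‖) := by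
  rw [norm_mul, norm_mul, norm_mul, norm_mul, norm_pow, norm_pow, Complex.norm_of_nonneg ha,
    Complex.norm_of_nonneg hb, norm_sign_eq_one hs]
  ring

/-- A single entry of a square-summable family is bounded by its `ℓ²`-bound:
`Σⱼ ‖vⱼ‖² ≤ B²`, `0 ≤ B` give `‖vⱼ‖ ≤ B`. [folklore] -/
theorem norm_le_of_tsum_sq_le {ι : Type*} {v : ι → ℂ} {B : ℝ} (hB : 0 ≤ B)
    (hs : Summable fun j => ‖v j‖ ^ 2) (hle : ∑' j, ‖v j‖ ^ 2 ≤ B ^ 2) (j : ι) : ‖v j‖ ≤ B := by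
  have h : ‖v j‖ ^ 2 ≤ ∑' k, ‖v k‖ ^ 2 := le_hasSum hs.hasSum j fun k _ => sq_nonneg _
  exact (sq_le_sq₀ (norm_nonneg _) hB).mp (h.trans hle)

/-- **Removing one term and comparing norms.**  If `Σ f = S` in `ℂ`, `Σ g = T` in `ℝ` and
`‖f i‖ ≤ g i` away from `i₀`, then `‖S − f i₀‖ ≤ T − g i₀`. [folklore] -/
theorem norm_sub_apply_le {ι : Type*} {f : ι → ℂ} {g : ι → ℝ} {S : ℂ} {T : ℝ}
    (hf : HasSum f S) (hg : HasSum g T) (i₀ : ι) (h : ∀ i, i ≠ i₀ → ‖f i‖ ≤ g i) :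
    ‖S - f i₀‖ ≤ T - g i₀ := by
  classical
  refine (hasSum_ite_sub_hasSum hf i₀).norm_le_of_bounded (hasSum_ite_sub_hasSum hg i₀) fun i => ?_
  by_cases hi : i = i₀
  · simp [hi]
  · simpa [hi] using h i hi

/-- **A family on `ι × ι` supported on one column.**  For `F ≥ 0` with `Σᵢ F i` convergent, the
family `(i, j) ↦ (if j = i₀ then c * F i else 0)` has sum `c * Σᵢ F i`. [folklore] -/
theorem hasSum_column {ι : Type*} [DecidableEq ι] {F : ι → ℝ} (hF : Summable F) (i₀ : ι) (c : ℝ) :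
    HasSum (fun p : ι × ι => if p.2 = i₀ then c * F p.1 else 0) (c * ∑' i, F i) := by
  have hinj : Function.Injective (fun i : ι => (i, i₀)) := fun a b h => congrArg Prod.fst h
  rw [← hinj.hasSum_iff]
  · simpa [Function.comp_def] using hF.hasSum.mul_left c
  · rintro ⟨i, j⟩ hp
    have hj : j ≠ i₀ := fun h => hp ⟨i, by rw [h]⟩
    exact if_neg hj

/-- **The numerator with its vacuum term removed.**  With normalised weights `r ≥ 0`, `r i₀ = 1`,
`r i ≤ ρ` for `i ≠ i₀`, signs `σ`, square-summable rows of `X` / columns of `X'` (bounds `BX`,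
`BX'`), the column `i₀` of `X` and the row `i₀` of `X'`, and `Σ r^M = 1 + δ'`:
`‖Σ_{(i,j)} σᵢ rᵢ^M rⱼ^n X_{ij} X'_{ji} − X_{i₀i₀} X'_{i₀i₀}‖ ≤ BX BX' (ρⁿ (1 + δ') + ρ^M)`. [folklore] -/
theorem norm_num_sub_le {ι : Type*} (r σ : ι → ℝ) (i₀ : ι) (ρ : ℝ) (M n : ℕ) (X X' : ι → ι → ℂ)
    (BX BX' δ' : ℝ) (Num : ℂ)
    (hr0 : ∀ i, 0 ≤ r i) (hr₀ : r i₀ = 1) (hρ : 0 ≤ ρ) (hrρ : ∀ i, i ≠ i₀ → r i ≤ ρ)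
    (hσ : ∀ i, σ i = 1 ∨ σ i = -1) (hσ₀ : σ i₀ = 1) (hBX : 0 ≤ BX) (hBX' : 0 ≤ BX')
    (hXr : ∀ i, Summable (fun j => ‖X i j‖ ^ 2) ∧ ∑' j, ‖X i j‖ ^ 2 ≤ BX ^ 2)
    (hXc₀ : Summable (fun i => ‖X i i₀‖ ^ 2) ∧ ∑' i, ‖X i i₀‖ ^ 2 ≤ BX ^ 2)
    (hX'r₀ : Summable (fun j => ‖X' i₀ j‖ ^ 2) ∧ ∑' j, ‖X' i₀ j‖ ^ 2 ≤ BX' ^ 2)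
    (hX'c : ∀ j, Summable (fun i => ‖X' i j‖ ^ 2) ∧ ∑' i, ‖X' i j‖ ^ 2 ≤ BX' ^ 2)
    (hδ' : HasSum (fun i => r i ^ M) (1 + δ'))
    (hNum : HasSum (fun p : ι × ι =>
      (σ p.1 : ℂ) * (r p.1 : ℂ) ^ M * (r p.2 : ℂ) ^ n * X p.1 p.2 * X' p.2 p.1) Num) :
    ‖Num - X i₀ i₀ * X' i₀ i₀‖ ≤ BX * BX' * (ρ ^ n * (1 + δ') + ρ ^ M) := by
  classical
  -- fibrewise Cauchy–Schwarz: rows of `X` against columns of `X'`, and the column/row at `i₀`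
  have hCSA : ∀ i, (Summable fun j => ‖X i j‖ * ‖X' j i‖) ∧ ∑' j, ‖X i j‖ * ‖X' j i‖ ≤ BX * BX' :=
    fun i => summable_mul_and_tsum_le (fun j => norm_nonneg _) (fun j => norm_nonneg _) hBX hBX'
      (hXr i).1 (hXr i).2 (hX'c i).1 (hX'c i).2
  have hCSB : (Summable fun i => ‖X i i₀‖ * ‖X' i₀ i‖) ∧ ∑' i, ‖X i i₀‖ * ‖X' i₀ i‖ ≤ BX * BX' :=
    summable_mul_and_tsum_le (fun j => norm_nonneg _) (fun j => norm_nonneg _) hBX hBX'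
      hXc₀.1 hXc₀.2 hX'r₀.1 hX'r₀.2
  -- the dominating family off the column `j = i₀`
  have hc0 : ∀ i, 0 ≤ ρ ^ n * r i ^ M := fun i => mul_nonneg (pow_nonneg hρ n) (pow_nonneg (hr0 i) M)
  have hc : HasSum (fun i => ρ ^ n * r i ^ M) (ρ ^ n * (1 + δ')) := hδ'.mul_left _
  obtain ⟨hAs, hAle⟩ := summable_prod_and_tsum_le (c := fun i => ρ ^ n * r i ^ M)
    (F := fun i j => ‖X i j‖ * ‖X' j i‖) hc0
    (fun i j => mul_nonneg (norm_nonneg _) (norm_nonneg _)) hc hCSA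
  -- the dominating family on the column `j = i₀`
  have hgB := hasSum_column hCSB.1 i₀ (ρ ^ M)
  -- termwise comparison of the vacuum-removed numerator family
  have key : ‖Num - (σ i₀ : ℂ) * (r i₀ : ℂ) ^ M * (r i₀ : ℂ) ^ n * X i₀ i₀ * X' i₀ i₀‖ ≤
      (∑' p : ι × ι, ρ ^ n * r p.1 ^ M * (‖X p.1 p.2‖ * ‖X' p.2 p.1‖)) +
        ρ ^ M * ∑' i, ‖X i i₀‖ * ‖X' i₀ i‖ := by
    refine (hasSum_ite_sub_hasSum hNum (i₀, i₀)).norm_le_of_bounded (hAs.hasSum.add hgB) ?_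
    rintro ⟨i, j⟩
    dsimp only
    have hnn : 0 ≤ ‖X i j‖ * ‖X' j i‖ := mul_nonneg (norm_nonneg _) (norm_nonneg _)
    have hgA0 : 0 ≤ ρ ^ n * r i ^ M * (‖X i j‖ * ‖X' j i‖) := mul_nonneg (hc0 i) hnn
    have hgB0 : 0 ≤ (if j = i₀ then ρ ^ M * (‖X i i₀‖ * ‖X' i₀ i‖) else 0) := by
      split_ifs
      · exact mul_nonneg (pow_nonneg hρ M) (mul_nonneg (norm_nonneg _) (norm_nonneg _))
      · exact le_rfl
    by_cases hp : (i, j) = (i₀, i₀)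
    · rw [if_pos hp, norm_zero]
      exact add_nonneg hgA0 hgB0
    · rw [if_neg hp, norm_term_eq (hσ i) (hr0 i) (hr0 j) M n]
      by_cases hj : j = i₀
      · have hi : i ≠ i₀ := fun hi => hp (by rw [hi, hj])
        have h1 : r i ^ M ≤ ρ ^ M := pow_le_pow_left₀ (hr0 i) (hrρ i hi) M
        rw [if_pos hj, hj, hr₀, one_pow, mul_one]
        rw [hj] at hnn hgA0
        have h2 : r i ^ M * (‖X i i₀‖ * ‖X' i₀ i‖) ≤ ρ ^ M * (‖X i i₀‖ * ‖X' i₀ i‖) :=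
          mul_le_mul_of_nonneg_right h1 hnn
        linarith
      · rw [if_neg hj, add_zero]
        have h1 : r j ^ n ≤ ρ ^ n := pow_le_pow_left₀ (hr0 j) (hrρ j hj) n
        calc r i ^ M * r j ^ n * (‖X i j‖ * ‖X' j i‖)
            ≤ r i ^ M * ρ ^ n * (‖X i j‖ * ‖X' j i‖) :=
              mul_le_mul_of_nonneg_right (mul_le_mul_of_nonneg_left h1 (pow_nonneg (hr0 i) M)) hnn
          _ = ρ ^ n * r i ^ M * (‖X i j‖ * ‖X' j i‖) := by ring
  rw [hσ₀, hr₀] at key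
  simp only [Complex.ofReal_one, one_pow, mul_one, one_mul] at key
  have hB : ρ ^ M * ∑' i, ‖X i i₀‖ * ‖X' i₀ i‖ ≤ ρ ^ M * (BX * BX') :=
    mul_le_mul_of_nonneg_left hCSB.2 (pow_nonneg hρ M)
  calc ‖Num - X i₀ i₀ * X' i₀ i₀‖
      ≤ (∑' p : ι × ι, ρ ^ n * r p.1 ^ M * (‖X p.1 p.2‖ * ‖X' p.2 p.1‖)) +
          ρ ^ M * ∑' i, ‖X i i₀‖ * ‖X' i₀ i‖ := key
    _ ≤ ρ ^ n * (1 + δ') * (BX * BX') + ρ ^ M * (BX * BX') := add_le_add hAle hB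
    _ = BX * BX' * (ρ ^ n * (1 + δ') + ρ ^ M) := by ring

/-- **The final algebra.**  From `‖a‖ ≤ BX`, `‖a'‖ ≤ BX'`, `‖Z − 1‖ ≤ δ < 1`, `‖O − a‖ ≤ δ BX`,
`‖O' − a'‖ ≤ δ BX'` and `‖Num − a a'‖ ≤ BX BX' T` (`T ≥ 0`):
`‖Num/Z − (O/Z)(O'/Z)‖ ≤ BX BX' ((1+δ) T + 3δ + δ²)/(1−δ)²`, via
`Num Z − O O' = a a' (Z−1) + (Num − a a') Z − a (O'−a') − (O−a) a' − (O−a)(O'−a')`. [folklore] -/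
theorem norm_connected_le {Z Num O O' a a' : ℂ} {BX BX' δ T : ℝ} (hBX : 0 ≤ BX) (hBX' : 0 ≤ BX')
    (hδ0 : 0 ≤ δ) (hδ1 : δ < 1) (hT : 0 ≤ T) (ha : ‖a‖ ≤ BX) (ha' : ‖a'‖ ≤ BX')
    (hz : ‖Z - 1‖ ≤ δ) (he : ‖O - a‖ ≤ δ * BX) (he' : ‖O' - a'‖ ≤ δ * BX')
    (ht : ‖Num - a * a'‖ ≤ BX * BX' * T) :
    ‖Num / Z - (O / Z) * (O' / Z)‖ ≤ BX * BX' * ((1 + δ) * T + 3 * δ + δ ^ 2) / (1 - δ) ^ 2 := by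
  have h1 := abs_norm_sub_norm_le Z 1
  rw [norm_one] at h1
  obtain ⟨h1a, h1b⟩ := abs_le.mp h1
  have hZl : 1 - δ ≤ ‖Z‖ := by linarith
  have hZu : ‖Z‖ ≤ 1 + δ := by linarith
  have hpos : 0 < 1 - δ := by linarith
  have hZpos : 0 < ‖Z‖ := lt_of_lt_of_le hpos hZl
  have hZne : Z ≠ 0 := norm_pos_iff.mp hZpos
  have hid : Num / Z - (O / Z) * (O' / Z) = (Num * Z - O * O') / Z ^ 2 := by
    field_simp
  have hexp : Num * Z - O * O' =
      a * a' * (Z - 1) + (Num - a * a') * Z - a * (O' - a') - (O - a) * a' - (O - a) * (O' - a') := by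
    ring
  have n1 : ‖a * a' * (Z - 1)‖ ≤ BX * BX' * δ := by
    rw [norm_mul, norm_mul]
    exact mul_le_mul (mul_le_mul ha ha' (norm_nonneg _) hBX) hz (norm_nonneg _)
      (mul_nonneg hBX hBX')
  have n2 : ‖(Num - a * a') * Z‖ ≤ BX * BX' * T * (1 + δ) := by
    rw [norm_mul]
    exact mul_le_mul ht hZu (norm_nonneg _) (by positivity)
  have n3 : ‖a * (O' - a')‖ ≤ BX * (δ * BX') := by
    rw [norm_mul]
    exact mul_le_mul ha he' (norm_nonneg _) hBX
  have n4 : ‖(O - a) * a'‖ ≤ δ * BX * BX' := by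
    rw [norm_mul]
    exact mul_le_mul he ha' (norm_nonneg _) (mul_nonneg hδ0 hBX)
  have n5 : ‖(O - a) * (O' - a')‖ ≤ δ * BX * (δ * BX') := by
    rw [norm_mul]
    exact mul_le_mul he he' (norm_nonneg _) (mul_nonneg hδ0 hBX)
  have t1 := norm_sub_le (a * a' * (Z - 1) + (Num - a * a') * Z - a * (O' - a') - (O - a) * a')
    ((O - a) * (O' - a'))
  have t2 := norm_sub_le (a * a' * (Z - 1) + (Num - a * a') * Z - a * (O' - a')) ((O - a) * a')
  have t3 := norm_sub_le (a * a' * (Z - 1) + (Num - a * a') * Z) (a * (O' - a'))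
  have t4 := norm_add_le (a * a' * (Z - 1)) ((Num - a * a') * Z)
  have hnum : ‖Num * Z - O * O'‖ ≤ BX * BX' * ((1 + δ) * T + 3 * δ + δ ^ 2) := by
    rw [hexp]
    linarith
  rw [hid, norm_div, norm_pow]
  exact div_le_div₀ (by positivity) hnum (by positivity) (pow_le_pow_left₀ hpos.le hZl 2)

/-- **Normalised twisted-ratio clustering** (vacuum level `r i₀ = 1`).  For weights `r ≥ 0` with
`r i₀ = 1` and `r i ≤ ρ` off `i₀`, signs `σ = ±1` with `σ i₀ = 1`, matrix entries `X, X'` with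
square-summable rows and columns (`ℓ²`-bounds `BX`, `BX'`), `Σ r^N = 1 + δ` with `δ < 1`,
`Σ r^M = 1 + δ'`, and the unconditional sums `Z = Σ σ r^N`, `Num = Σ_{(i,j)} σᵢ rᵢ^M rⱼ^n X_{ij} X'_{ji}`,
`O = Σ σ r^N X_{ii}`, `O' = Σ σ r^N X'_{ii}`:
`‖Num/Z − (O/Z)(O'/Z)‖ ≤ BX BX' ((1+δ)(ρⁿ(1+δ') + ρ^M) + 3δ + δ²)/(1−δ)²`. [folklore] -/
theorem norm_ratio_sub_le {ι : Type*} (r σ : ι → ℝ) (i₀ : ι) (ρ : ℝ) (N M n : ℕ)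
    (X X' : ι → ι → ℂ) (BX BX' δ δ' : ℝ) (Z Num O O' : ℂ)
    (hr0 : ∀ i, 0 ≤ r i) (hr₀ : r i₀ = 1) (hρ : 0 ≤ ρ) (hrρ : ∀ i, i ≠ i₀ → r i ≤ ρ)
    (hσ : ∀ i, σ i = 1 ∨ σ i = -1) (hσ₀ : σ i₀ = 1) (hBX : 0 ≤ BX) (hBX' : 0 ≤ BX')
    (hXr : ∀ i, Summable (fun j => ‖X i j‖ ^ 2) ∧ ∑' j, ‖X i j‖ ^ 2 ≤ BX ^ 2)
    (hXc₀ : Summable (fun i => ‖X i i₀‖ ^ 2) ∧ ∑' i, ‖X i i₀‖ ^ 2 ≤ BX ^ 2)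
    (hX'r₀ : Summable (fun j => ‖X' i₀ j‖ ^ 2) ∧ ∑' j, ‖X' i₀ j‖ ^ 2 ≤ BX' ^ 2)
    (hX'c : ∀ j, Summable (fun i => ‖X' i j‖ ^ 2) ∧ ∑' i, ‖X' i j‖ ^ 2 ≤ BX' ^ 2)
    (hδ : HasSum (fun i => r i ^ N) (1 + δ)) (hδ1 : δ < 1)
    (hδ' : HasSum (fun i => r i ^ M) (1 + δ'))
    (hZ : HasSum (fun i => (σ i : ℂ) * (r i : ℂ) ^ N) Z)
    (hNum : HasSum (fun p : ι × ι =>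
      (σ p.1 : ℂ) * (r p.1 : ℂ) ^ M * (r p.2 : ℂ) ^ n * X p.1 p.2 * X' p.2 p.1) Num)
    (hO : HasSum (fun i => (σ i : ℂ) * (r i : ℂ) ^ N * X i i) O)
    (hO' : HasSum (fun i => (σ i : ℂ) * (r i : ℂ) ^ N * X' i i) O') :
    ‖Num / Z - (O / Z) * (O' / Z)‖ ≤
      BX * BX' * ((1 + δ) * (ρ ^ n * (1 + δ') + ρ ^ M) + 3 * δ + δ ^ 2) / (1 - δ) ^ 2 := by
  -- scalar bounds
  have ha : ‖X i₀ i₀‖ ≤ BX := norm_le_of_tsum_sq_le hBX (hXr i₀).1 (hXr i₀).2 i₀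
  have ha' : ‖X' i₀ i₀‖ ≤ BX' := norm_le_of_tsum_sq_le hBX' (hX'c i₀).1 (hX'c i₀).2 i₀
  have hδ0 : 0 ≤ δ := by
    have h := le_hasSum hδ i₀ fun j _ => pow_nonneg (hr0 j) N
    rw [hr₀, one_pow] at h
    linarith
  have hδ'0 : 0 ≤ 1 + δ' := hδ'.nonneg fun i => pow_nonneg (hr0 i) M
  have hT : 0 ≤ ρ ^ n * (1 + δ') + ρ ^ M := by positivity
  -- the denominator: `‖Z - 1‖ ≤ δ`
  have htZ : ∀ i, i ≠ i₀ → ‖(σ i : ℂ) * (r i : ℂ) ^ N‖ ≤ r i ^ N := fun i _ => by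
    rw [norm_mul, norm_sign_eq_one (hσ i), one_mul, norm_pow, Complex.norm_of_nonneg (hr0 i)]
  have hz : ‖Z - 1‖ ≤ δ := by
    have h := norm_sub_apply_le hZ hδ i₀ htZ
    rw [hσ₀, hr₀] at h
    simp only [Complex.ofReal_one, one_pow, mul_one] at h
    linarith
  -- the one-point sums: `‖O - X₀₀‖ ≤ δ BX`, `‖O' - X'₀₀‖ ≤ δ BX'`
  have htO : ∀ i, i ≠ i₀ → ‖(σ i : ℂ) * (r i : ℂ) ^ N * X i i‖ ≤ r i ^ N * BX := fun i _ => by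
    rw [norm_mul, norm_mul, norm_sign_eq_one (hσ i), one_mul, norm_pow,
      Complex.norm_of_nonneg (hr0 i)]
    exact mul_le_mul_of_nonneg_left (norm_le_of_tsum_sq_le hBX (hXr i).1 (hXr i).2 i)
      (pow_nonneg (hr0 i) N)
  have htO' : ∀ i, i ≠ i₀ → ‖(σ i : ℂ) * (r i : ℂ) ^ N * X' i i‖ ≤ r i ^ N * BX' := fun i _ => by
    rw [norm_mul, norm_mul, norm_sign_eq_one (hσ i), one_mul, norm_pow,
      Complex.norm_of_nonneg (hr0 i)]
    exact mul_le_mul_of_nonneg_left (norm_le_of_tsum_sq_le hBX' (hX'c i).1 (hX'c i).2 i)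
      (pow_nonneg (hr0 i) N)
  have he : ‖O - X i₀ i₀‖ ≤ δ * BX := by
    have h := norm_sub_apply_le hO (hδ.mul_right BX) i₀ htO
    rw [hσ₀, hr₀] at h
    simp only [Complex.ofReal_one, one_pow, mul_one, one_mul] at h
    linarith
  have he' : ‖O' - X' i₀ i₀‖ ≤ δ * BX' := by
    have h := norm_sub_apply_le hO' (hδ.mul_right BX') i₀ htO'
    rw [hσ₀, hr₀] at h
    simp only [Complex.ofReal_one, one_pow, mul_one, one_mul] at h
    linarith
  -- the numerator
  have ht := norm_num_sub_le r σ i₀ ρ M n X X' BX BX' δ' Num hr0 hr₀ hρ hrρ hσ hσ₀ hBX hBX' hXr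
    hXc₀ hX'r₀ hX'c hδ' hNum
  exact norm_connected_le hBX hBX' hδ0 hδ1 hT ha ha' hz he he' ht

end StubTwistedRatioCluster

open StubTwistedRatioCluster in
/-- **U4 (M5): the twisted-ratio clustering algebra** — connected twisted ratios of two insertions
from spectral data.  For eigenvalues `0 ≤ lam i ≤ lam i₀`, `0 < lam i₀`, excited levels
`lam i ≤ l₁` (`i ≠ i₀`), parities `σ i = ±1` with `σ i₀ = 1`, matrix entries `X, X'` with
square-summable rows and columns of `ℓ²`-norms at most `BX, BX'`, `n ≤ N`,
`Σ (lam i / lam i₀)^N = 1 + δ` with `δ < 1`, `Σ (lam i / lam i₀)^(N-n) = 1 + δ'`, and the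
unconditional sums `Z = Σ σᵢ λᵢ^N`, `Num = Σ_{(i,j)} σᵢ λᵢ^{N-n} λⱼ^n X_{ij} X'_{ji}`,
`O = Σ σᵢ λᵢ^N X_{ii}`, `O' = Σ σᵢ λᵢ^N X'_{ii}`:
`‖Num/Z − (O/Z)(O'/Z)‖ ≤ BX BX' ((1+δ)((l₁/λ_{i₀})ⁿ(1+δ') + (l₁/λ_{i₀})^{N-n}) + 3δ + δ²)/(1−δ)²`
(normalise by `λ_{i₀}^N` and apply `StubTwistedRatioCluster.norm_ratio_sub_le`).  The statement is
the registered stub signature verbatim. [folklore] -/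
theorem stub_twistedRatio_cluster :
    ∀ (ι : Type) [Countable ι] (lam σ : ι → ℝ) (i₀ : ι) (l₁ : ℝ) (N n : ℕ) (X X' : ι → ι → ℂ)
      (BX BX' δ δ' : ℝ) (Z Num O O' : ℂ),
      (∀ i, 0 ≤ lam i ∧ lam i ≤ lam i₀) → 0 < lam i₀ → 0 ≤ l₁ → (∀ i, i ≠ i₀ → lam i ≤ l₁) →
      (∀ i, σ i = 1 ∨ σ i = -1) → σ i₀ = 1 → 0 ≤ BX → 0 ≤ BX' →
      (∀ i, Summable (fun j => ‖X i j‖ ^ 2) ∧ ∑' j, ‖X i j‖ ^ 2 ≤ BX ^ 2) →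
      (∀ j, Summable (fun i => ‖X i j‖ ^ 2) ∧ ∑' i, ‖X i j‖ ^ 2 ≤ BX ^ 2) →
      (∀ i, Summable (fun j => ‖X' i j‖ ^ 2) ∧ ∑' j, ‖X' i j‖ ^ 2 ≤ BX' ^ 2) →
      (∀ j, Summable (fun i => ‖X' i j‖ ^ 2) ∧ ∑' i, ‖X' i j‖ ^ 2 ≤ BX' ^ 2) →
      n ≤ N → HasSum (fun i => (lam i / lam i₀) ^ N) (1 + δ) → δ < 1 →
      HasSum (fun i => (lam i / lam i₀) ^ (N - n)) (1 + δ') →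
      HasSum (fun i => (σ i : ℂ) * (lam i : ℂ) ^ N) Z →
      HasSum (fun p : ι × ι => (σ p.1 : ℂ) * (lam p.1 : ℂ) ^ (N - n) * (lam p.2 : ℂ) ^ n * X p.1 p.2 * X' p.2 p.1) Num →
      HasSum (fun i => (σ i : ℂ) * (lam i : ℂ) ^ N * X i i) O →
      HasSum (fun i => (σ i : ℂ) * (lam i : ℂ) ^ N * X' i i) O' →
      ‖Num / Z - (O / Z) * (O' / Z)‖ ≤
        BX * BX' * ((1 + δ) * ((l₁ / lam i₀) ^ n * (1 + δ') + (l₁ / lam i₀) ^ (N - n)) + 3 * δ + δ ^ 2) /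
          (1 - δ) ^ 2 := by
  intro ι _ lam σ i₀ l₁ N n X X' BX BX' δ δ' Z Num O O' hlam hl0 hl1 hgap hσ hσ₀ hBX hBX' hXr hXc
    hX'r hX'c hnN hδ hδ1 hδ' hZ hNum hO hO'
  -- normalise by the vacuum weight `L = (lam i₀)^N`
  have hl0' : (lam i₀ : ℂ) ≠ 0 := Complex.ofReal_ne_zero.mpr hl0.ne'
  have hLc : (lam i₀ : ℂ) ^ N ≠ 0 := pow_ne_zero N hl0'
  have hr0 : ∀ i, 0 ≤ lam i / lam i₀ := fun i => div_nonneg (hlam i).1 hl0.le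
  have hr₀ : lam i₀ / lam i₀ = 1 := div_self hl0.ne'
  have hρ : 0 ≤ l₁ / lam i₀ := div_nonneg hl1 hl0.le
  have hrρ : ∀ i, i ≠ i₀ → lam i / lam i₀ ≤ l₁ / lam i₀ :=
    fun i hi => div_le_div_of_nonneg_right (hgap i hi) hl0.le
  have hZ' : HasSum (fun i => (σ i : ℂ) * ((lam i / lam i₀ : ℝ) : ℂ) ^ N)
      (Z / (lam i₀ : ℂ) ^ N) :=
    (hZ.div_const ((lam i₀ : ℂ) ^ N)).congr_fun fun i => by
      push_cast
      rw [div_pow]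
      ring
  have hO₁ : HasSum (fun i => (σ i : ℂ) * ((lam i / lam i₀ : ℝ) : ℂ) ^ N * X i i)
      (O / (lam i₀ : ℂ) ^ N) :=
    (hO.div_const ((lam i₀ : ℂ) ^ N)).congr_fun fun i => by
      push_cast
      rw [div_pow]
      ring
  have hO₁' : HasSum (fun i => (σ i : ℂ) * ((lam i / lam i₀ : ℝ) : ℂ) ^ N * X' i i)
      (O' / (lam i₀ : ℂ) ^ N) :=
    (hO'.div_const ((lam i₀ : ℂ) ^ N)).congr_fun fun i => by
      push_cast
      rw [div_pow]
      ring
  have hNum' : HasSum (fun p : ι × ι => (σ p.1 : ℂ) * ((lam p.1 / lam i₀ : ℝ) : ℂ) ^ (N - n) *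
      ((lam p.2 / lam i₀ : ℝ) : ℂ) ^ n * X p.1 p.2 * X' p.2 p.1) (Num / (lam i₀ : ℂ) ^ N) :=
    (hNum.div_const ((lam i₀ : ℂ) ^ N)).congr_fun fun p => by
      rw [← pow_sub_mul_pow (lam i₀ : ℂ) hnN]
      push_cast
      rw [div_pow, div_pow]
      ring
  have key := norm_ratio_sub_le (fun i => lam i / lam i₀) σ i₀ (l₁ / lam i₀) N (N - n) n X X'
    BX BX' δ δ' (Z / (lam i₀ : ℂ) ^ N) (Num / (lam i₀ : ℂ) ^ N) (O / (lam i₀ : ℂ) ^ N)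
    (O' / (lam i₀ : ℂ) ^ N) hr0 hr₀ hρ hrρ hσ hσ₀ hBX hBX' hXr (hXc i₀) (hX'r i₀) hX'c hδ hδ1 hδ'
    hZ' hNum' hO₁ hO₁'
  rwa [div_div_div_cancel_right₀ hLc, div_div_div_cancel_right₀ hLc,
    div_div_div_cancel_right₀ hLc] at key

end Summit.QuantumFields.QCD.Cruxes.RobustYangMillsHandover.PinTheInfimum
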